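import Mathlib
import Summits.MatrixMultiplication.MatrixMultiplication.Theorems.FourierTwoFamiliesModPPrimeLogDecayStubThetaCommonSide

/-!
# Several common-side classes are jointly wall-bounded (helper for crux `PrimeLogDecay`)

Crux `stmt-MatrixMultiplication-14310` (`FourierTwoFamiliesModP.PrimeLogDecay`), line
`fixed-delta-theta-certificate`; closes the registered milestone stub `stub_thetaCommonSideClasses`, extending the landed
`CommonSide.stub_thetaCommonSide` (file `…PrimeLogDecayStubThetaCommonSide`, imported: `entry_eq_zero_of_commonSide`, `filter_meets_vadd_eq_sub`,
`card_sub_eq_mul_of_direct`).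

If every vertex of the diagonal support has its `A`-side a translate of a member of `SA` OR its `B`-side a
translate of a member of `SB`, then `s² · Σ B ≤ (|SA| + |SB|) · |G| · tr B`.  This contains the landed
single-class bound `CommonSide.stub_thetaCommonSide` (`SA = {A₀}`, `SB = ∅`) and the sibling's shape-count bound (`K` shapes are `K` classes), and it
is what makes "sumset worlds" `X₀ = (A₀ − B₀) + U` harmless: with a generic tile and `|U| = s` every admissible
shape lies in one of six classes (crux NOTES §3).  Mechanism: assign each support vertex ONE of its classes;
the cliques are "same assigned class `σ`, and the free side meets `c +ᵥ σ`" (`entry_eq_zero_of_commonSide`,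
`clique_of_commonBSide`); a support vertex lies in exactly `s²` cliques of its own class and in none of
the others, so `CliqueCover.value_le_of_cliqueCover` applies with weights `1/s²` on the `(|SA| + |SB|) · |G|`
relevant cliques and multiplicity `1`.
-/

namespace Summit.MatrixMultiplication.MatrixMultiplication.Theorems.PrimeLogDecayTheta.CommonSideClasses

open Finset
open scoped Pointwise BigOperators
open Summit.MatrixMultiplication.MatrixMultiplication.Theorems.PrimeCyclicPowerGainTheta
open Summit.MatrixMultiplication.MatrixMultiplication.Theorems.PrimeLogDecayTheta.CommonSide

/-- **Common-side clique, `B`-side form.**  If `w.2 = x +ᵥ B₀` and both `v.1` and `w.1` meet `c +ᵥ B₀`, then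
`B v w = 0` for `v ≠ w`: with `c + b₁ ∈ v.1`, `c + b₂ ∈ w.1`,
`(c + b₁) − (x + b₁) = c − x = (c + b₂) − (x + b₂) ∈ (w.1 − w.2) ⊆ X₀` lies in `v.1 − w.2`. -/
theorem clique_of_commonBSide {G : Type*} [AddCommGroup G] [DecidableEq G] (X₀ B₀ : Finset G)
    (B : Finset G × Finset G → Finset G × Finset G → ℝ)
    (hsupp : ∀ v w : Finset G × Finset G, B v w ≠ 0 →
      w.1 - w.2 ⊆ X₀ ∧ (v = w ∨ (Disjoint (v.1 - w.2) X₀ ∧ Disjoint (w.1 - v.2) X₀)))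
    (c x : G) (v w : Finset G × Finset G) (hvw : v ≠ w) (hwB : w.2 = x +ᵥ B₀)
    (hv : ((c +ᵥ B₀) ∩ v.1).Nonempty) (hw : ((c +ᵥ B₀) ∩ w.1).Nonempty) : B v w = 0 := by
  by_contra hB
  obtain ⟨hsub, h⟩ := hsupp v w hB
  rcases h with h | ⟨hdis, _⟩
  · exact hvw h
  · obtain ⟨y, hy⟩ := hv
    obtain ⟨y', hy'⟩ := hw
    rw [Finset.mem_inter, Finset.mem_vadd_finset] at hy hy'
    obtain ⟨⟨b₁, hb₁, rfl⟩, hv1⟩ := hy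
    obtain ⟨⟨b₂, hb₂, rfl⟩, hw1⟩ := hy'
    have hxb₁ : x +ᵥ b₁ ∈ w.2 := by
      rw [hwB]
      exact (Finset.vadd_mem_vadd_finset_iff x).2 hb₁
    have hxb₂ : x +ᵥ b₂ ∈ w.2 := by
      rw [hwB]
      exact (Finset.vadd_mem_vadd_finset_iff x).2 hb₂
    -- `c - x = (c + b₂) - (x + b₂) ∈ w.1 - w.2 ⊆ X₀`
    have hX : c - x ∈ X₀ := by
      have hmem : (c +ᵥ b₂) - (x +ᵥ b₂) ∈ w.1 - w.2 := Finset.sub_mem_sub hw1 hxb₂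
      have e : (c +ᵥ b₂) - (x +ᵥ b₂) = c - x := by
        simp only [vadd_eq_add]
        abel
      rw [e] at hmem
      exact hsub hmem
    -- `c - x = (c + b₁) - (x + b₁) ∈ v.1 - w.2`
    have hbad : c - x ∈ v.1 - w.2 := by
      have hmem : (c +ᵥ b₁) - (x +ᵥ b₁) ∈ v.1 - w.2 := Finset.sub_mem_sub hv1 hxb₁
      have e : (c +ᵥ b₁) - (x +ᵥ b₁) = c - x := by
        simp only [vadd_eq_add]
        abel
      rw [e] at hmem
      exact hmem
    exact Finset.disjoint_left.1 hdis hbad hX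

/-- Directness of `(T, x +ᵥ B₀)` makes `(a, b) ↦ a − b` injective on `T × B₀`: `|T − B₀| = |T| · |B₀|`. -/
theorem card_sub_of_direct_right {G : Type*} [AddCommGroup G] [DecidableEq G] (B₀ T : Finset G) (x : G)
    (hW : ∀ a ∈ T, ∀ a' ∈ T, ∀ b ∈ x +ᵥ B₀, ∀ b' ∈ x +ᵥ B₀, (a - a') + (b - b') = 0 → a = a' ∧ b = b') :
    (T - B₀).card = T.card * B₀.card := by
  rw [Finset.sub_def, ← Finset.card_product, Finset.card_image_iff]
  rintro ⟨a, b⟩ hab ⟨a', b'⟩ hab' h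
  simp only [Finset.coe_product, Set.mem_prod, Finset.mem_coe] at hab hab'
  simp only at h
  -- `a - b = a' - b'` gives `(a - a') + ((x + b') - (x + b)) = 0`
  have h0 : (a - a') + ((x +ᵥ b') - (x +ᵥ b)) = 0 := by
    have e : (a - a') + ((x +ᵥ b') - (x +ᵥ b)) = (a - b) - (a' - b') := by
      simp only [vadd_eq_add]
      abel
    rw [e, h, sub_self]
  obtain ⟨e1, e2⟩ := hW a hab.1 a' hab'.1 (x +ᵥ b') ((Finset.vadd_mem_vadd_finset_iff x).2 hab'.2)
    (x +ᵥ b) ((Finset.vadd_mem_vadd_finset_iff x).2 hab.2) h0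
  have e3 : b' = b := by
    simp only [vadd_eq_add] at e2
    exact add_left_cancel e2
  rw [e1, e3]

/-- **Several common-side classes.**  `G` a finite additive commutative group; `B` a symmetric PSD
entrywise-nonnegative kernel on block pairs whose nonzero entries sit on admissible equal-or-compatible pairs
(the bet's support hypothesis); every vertex of the diagonal support has its `A`-side a translate of a member
of `SA` or its `B`-side a translate of a member of `SB`.  Then `s² · Σ_{v,w} B v w ≤ (|SA| + |SB|) · |G| · Σ_v B v v`. -/
theorem sq_mul_value_le_of_commonSideClasses {G : Type*} [AddCommGroup G] [Fintype G] [DecidableEq G]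
    (s : ℕ) (X₀ : Finset G) (SA SB : Finset (Finset G))
    (B : Finset G × Finset G → Finset G × Finset G → ℝ)
    (hsymm : ∀ v w, B v w = B w v)
    (hpsd : ∀ x : Finset G × Finset G → ℝ, 0 ≤ ∑ v, ∑ w, x v * B v w * x w)
    (hnn : ∀ v w, 0 ≤ B v w)
    (hsupp : ∀ v w : Finset G × Finset G, B v w ≠ 0 →
      (v.1.card = s ∧ v.2.card = s ∧
        (∀ a ∈ v.1, ∀ a' ∈ v.1, ∀ b ∈ v.2, ∀ b' ∈ v.2, (a - a') + (b - b') = 0 → a = a' ∧ b = b') ∧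
        v.1 - v.2 ⊆ X₀) ∧
      (w.1.card = s ∧ w.2.card = s ∧
        (∀ a ∈ w.1, ∀ a' ∈ w.1, ∀ b ∈ w.2, ∀ b' ∈ w.2, (a - a') + (b - b') = 0 → a = a' ∧ b = b') ∧
        w.1 - w.2 ⊆ X₀) ∧
      (v = w ∨ (Disjoint (v.1 - w.2) X₀ ∧ Disjoint (w.1 - v.2) X₀)))
    (hcls : ∀ v : Finset G × Finset G, B v v ≠ 0 →
      (∃ A₀ ∈ SA, ∃ x : G, v.1 = x +ᵥ A₀) ∨ (∃ B₀ ∈ SB, ∃ x : G, v.2 = x +ᵥ B₀)) :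
    (s : ℝ) ^ 2 * ∑ v, ∑ w, B v w ≤
      ((SA.card : ℝ) + (SB.card : ℝ)) * (Fintype.card G : ℝ) * ∑ v, B v v := by
  classical
  have htr : 0 ≤ ∑ v, B v v := Finset.sum_nonneg fun v _ => hnn v v
  rcases Nat.eq_zero_or_pos s with hs0 | hspos
  · subst hs0
    simp only [Nat.cast_zero, ne_eq, OfNat.ofNat_ne_zero, not_false_eq_true, zero_pow, zero_mul]
    positivity
  have hsR : (0 : ℝ) < s := Nat.cast_pos.2 hspos
  have hs2 : (0 : ℝ) < (s : ℝ) ^ 2 := by positivity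
  -- support hypothesis in the two short forms used by the clique lemmas
  have hsuppA : ∀ v w : Finset G × Finset G, B v w ≠ 0 →
      v.1 - v.2 ⊆ X₀ ∧ (v = w ∨ (Disjoint (v.1 - w.2) X₀ ∧ Disjoint (w.1 - v.2) X₀)) := by
    intro v w h
    obtain ⟨⟨-, -, -, hsub⟩, -, hc⟩ := hsupp v w h
    exact ⟨hsub, hc⟩
  have hsuppB : ∀ v w : Finset G × Finset G, B v w ≠ 0 →
      w.1 - w.2 ⊆ X₀ ∧ (v = w ∨ (Disjoint (v.1 - w.2) X₀ ∧ Disjoint (w.1 - v.2) X₀)) := by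
    intro v w h
    obtain ⟨-, ⟨-, -, -, hsub⟩, hc⟩ := hsupp v w h
    exact ⟨hsub, hc⟩
  -- a class assignment: each vertex gets ONE of its common-side descriptions (if any)
  have hex : ∃ cls : Finset G × Finset G → Option (Finset G ⊕ Finset G),
      (∀ v A₀, cls v = some (Sum.inl A₀) → A₀ ∈ SA ∧ ∃ x : G, v.1 = x +ᵥ A₀) ∧
      (∀ v B₀, cls v = some (Sum.inr B₀) → B₀ ∈ SB ∧ ∃ x : G, v.2 = x +ᵥ B₀) ∧
      (∀ v, B v v ≠ 0 → cls v ≠ none) := by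
    refine ⟨fun v => if h : ∃ A₀ ∈ SA, ∃ x : G, v.1 = x +ᵥ A₀ then some (Sum.inl h.choose)
        else if h' : ∃ B₀ ∈ SB, ∃ x : G, v.2 = x +ᵥ B₀ then some (Sum.inr h'.choose) else none,
      ?_, ?_, ?_⟩
    · intro v A₀ hv
      dsimp only at hv
      split_ifs at hv with h h'
      · have e : h.choose = A₀ := by simpa using hv
        rw [← e]
        exact h.choose_spec
      · simp at hv
    · intro v B₀ hv
      dsimp only at hv
      split_ifs at hv with h h'
      · simp at hv
      · have e : h'.choose = B₀ := by simpa using hv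
        rw [← e]
        exact h'.choose_spec
    · intro v hv
      dsimp only
      rcases hcls v hv with ⟨A₀, hA₀, x, hx⟩ | ⟨B₀, hB₀, x, hx⟩
      · rw [dif_pos ⟨A₀, hA₀, x, hx⟩]
        exact Option.some_ne_none _
      · by_cases h : ∃ A₀ ∈ SA, ∃ x : G, v.1 = x +ᵥ A₀
        · rw [dif_pos h]
          exact Option.some_ne_none _
        · rw [dif_neg h, dif_pos ⟨B₀, hB₀, x, hx⟩]
          exact Option.some_ne_none _
  obtain ⟨cls, hclsA, hclsB, hclsS⟩ := hex
  -- "the free side of `v` meets `c +ᵥ σ`"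
  set meets : Finset G ⊕ Finset G → G → Finset G × Finset G → Prop := fun σ c v =>
    Sum.elim (fun A₀ : Finset G => ((c +ᵥ A₀) ∩ v.2).Nonempty)
      (fun B₀ : Finset G => ((c +ᵥ B₀) ∩ v.1).Nonempty) σ with hmeets
  -- the cliques, indexed by (class, translate)
  set C : (Finset G ⊕ Finset G) × G → Finset (Finset G × Finset G) := fun i =>
    Finset.univ.filter fun v : Finset G × Finset G => cls v = some i.1 ∧ meets i.1 i.2 v with hC
  have hmem : ∀ i v, v ∈ C i ↔ cls v = some i.1 ∧ meets i.1 i.2 v := by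
    intro i v
    simp only [hC, Finset.mem_filter, Finset.mem_univ, true_and]
  have hclique : ∀ i, ∀ v ∈ C i, ∀ w ∈ C i, v ≠ w → B v w = 0 := by
    rintro ⟨σ, c⟩ v hv w hw hvw
    rw [hmem] at hv hw
    rcases σ with A₀ | B₀
    · obtain ⟨-, x, hx⟩ := hclsA v A₀ hv.1
      have hv2 : ((c +ᵥ A₀) ∩ v.2).Nonempty := by simpa [hmeets] using hv.2
      have hw2 : ((c +ᵥ A₀) ∩ w.2).Nonempty := by simpa [hmeets] using hw.2
      exact entry_eq_zero_of_commonSide X₀ A₀ B hsuppA c x v w hvw hx hv2 hw2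
    · obtain ⟨-, x, hx⟩ := hclsB w B₀ hw.1
      have hv1 : ((c +ᵥ B₀) ∩ v.1).Nonempty := by simpa [hmeets] using hv.2
      have hw1 : ((c +ᵥ B₀) ∩ w.1).Nonempty := by simpa [hmeets] using hw.2
      exact clique_of_commonBSide X₀ B₀ B hsuppB c x v w hvw hx hv1 hw1
  -- the relevant classes and the weights
  set T : Finset (Finset G ⊕ Finset G) := SA.disjSum SB with hT
  set y : (Finset G ⊕ Finset G) × G → ℝ := fun i => if i.1 ∈ T then 1 / (s : ℝ) ^ 2 else 0 with hy
  have hy0 : ∀ i, 0 ≤ y i := by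
    intro i
    simp only [hy]
    split_ifs <;> positivity
  have hsumy : ∑ i, y i = ((SA.card : ℝ) + (SB.card : ℝ)) * (Fintype.card G : ℝ) / (s : ℝ) ^ 2 := by
    rw [Fintype.sum_prod_type]
    simp only [hy]
    rw [Finset.sum_comm]
    simp only [Finset.sum_ite_mem, Finset.univ_inter, Finset.sum_const, nsmul_eq_mul, hT,
      Finset.card_disjSum, Finset.card_univ, Nat.cast_add]
    ring
  -- a support vertex: its class is relevant, and exactly `s²` translates of the class meet its free side
  have hcount : ∀ v, B v v ≠ 0 → ∀ σ, cls v = some σ →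
      σ ∈ T ∧ (Finset.univ.filter fun c : G => meets σ c v).card = s * s := by
    intro v hv σ hσ
    obtain ⟨⟨h1, h2, hW, -⟩, -, -⟩ := hsupp v v hv
    rcases σ with A₀ | B₀
    · obtain ⟨hA₀, x, hx⟩ := hclsA v A₀ hσ
      refine ⟨by rw [hT]; exact Finset.inl_mem_disjSum.2 hA₀, ?_⟩
      have hcardA : A₀.card = s := by
        have := congrArg Finset.card hx
        rw [Finset.card_vadd_finset] at this
        omega
      have hW' : ∀ a ∈ x +ᵥ A₀, ∀ a' ∈ x +ᵥ A₀, ∀ b ∈ v.2, ∀ b' ∈ v.2,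
          (a - a') + (b - b') = 0 → a = a' ∧ b = b' := by
        rw [← hx]
        exact hW
      have e : (Finset.univ.filter fun c : G => meets (Sum.inl A₀) c v) =
          Finset.univ.filter fun c : G => ((c +ᵥ A₀) ∩ v.2).Nonempty :=
        Finset.filter_congr fun c _ => by simp [hmeets]
      rw [e, filter_meets_vadd_eq_sub, card_sub_eq_mul_of_direct A₀ v.2 x hW', h2, hcardA]
    · obtain ⟨hB₀, x, hx⟩ := hclsB v B₀ hσ
      refine ⟨by rw [hT]; exact Finset.inr_mem_disjSum.2 hB₀, ?_⟩
      have hcardB : B₀.card = s := by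
        have := congrArg Finset.card hx
        rw [Finset.card_vadd_finset] at this
        omega
      have hW' : ∀ a ∈ v.1, ∀ a' ∈ v.1, ∀ b ∈ x +ᵥ B₀, ∀ b' ∈ x +ᵥ B₀,
          (a - a') + (b - b') = 0 → a = a' ∧ b = b' := by
        rw [← hx]
        exact hW
      have e : (Finset.univ.filter fun c : G => meets (Sum.inr B₀) c v) =
          Finset.univ.filter fun c : G => ((c +ᵥ B₀) ∩ v.1).Nonempty :=
        Finset.filter_congr fun c _ => by simp [hmeets]
      rw [e, filter_meets_vadd_eq_sub, card_sub_of_direct_right B₀ v.1 x hW', h1, hcardB]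
  -- hence the cover multiplicity of a support vertex is exactly `1`
  have hY : ∀ v : Finset G × Finset G, B v v ≠ 0 → (∑ i, if v ∈ C i then y i else 0) = 1 := by
    intro v hv
    obtain ⟨σ₀, hσ₀⟩ := Option.ne_none_iff_exists'.1 (hclsS v hv)
    obtain ⟨hσT, hcard⟩ := hcount v hv σ₀ hσ₀
    rw [Fintype.sum_prod_type, Finset.sum_eq_single σ₀]
    · -- the own class: `s²` cliques of weight `1/s²`
      have e : ∀ c : G, (if v ∈ C (σ₀, c) then y (σ₀, c) else 0) =
          if meets σ₀ c v then 1 / (s : ℝ) ^ 2 else 0 := by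
        intro c
        simp only [hmem, hσ₀, true_and, hy, hσT, if_true]
      simp only [e]
      rw [Finset.sum_ite, Finset.sum_const_zero, add_zero, Finset.sum_const, nsmul_eq_mul, hcard]
      push_cast
      field_simp
    · -- other classes contribute nothing
      intro σ _ hne
      refine Finset.sum_eq_zero fun c _ => ?_
      rw [if_neg]
      rw [hmem]
      rintro ⟨h, -⟩
      rw [hσ₀] at h
      exact hne (Option.some_injective _ h).symm
    · intro h
      exact absurd (Finset.mem_univ σ₀) h
  have hcov : ∀ v, B v v ≠ 0 → 1 ≤ ∑ i, if v ∈ C i then y i else 0 := by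
    intro v hv
    rw [hY v hv]
  have hmult : ∀ v, B v v ≠ 0 → (∑ i, if v ∈ C i then y i else 0) ≤ 1 := by
    intro v hv
    rw [hY v hv]
  have key : ∑ v, ∑ w, B v w ≤ (1 : ℝ) * (∑ i, y i) * ∑ v, B v v :=
    CliqueCover.value_le_of_cliqueCover B C y 1 hsymm hpsd hnn hy0 hclique hcov hmult
  rw [hsumy] at key
  have e : (1 : ℝ) * (((SA.card : ℝ) + (SB.card : ℝ)) * (Fintype.card G : ℝ) / (s : ℝ) ^ 2) * ∑ v, B v v =
      ((SA.card : ℝ) + (SB.card : ℝ)) * (Fintype.card G : ℝ) * (∑ v, B v v) / (s : ℝ) ^ 2 := by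
    ring
  rw [e, le_div_iff₀ hs2] at key
  calc (s : ℝ) ^ 2 * ∑ v, ∑ w, B v w = (∑ v, ∑ w, B v w) * (s : ℝ) ^ 2 := mul_comm _ _
    _ ≤ ((SA.card : ℝ) + (SB.card : ℝ)) * (Fintype.card G : ℝ) * ∑ v, B v v := key

/-- **Registered milestone stub `stub_thetaCommonSideClasses`** (crux stmt-MatrixMultiplication-14310, line
fixed-delta-theta-certificate): several common-side classes.  With the bet's support hypothesis verbatim (`G` for
`ZMod p`): if every vertex of the diagonal support has its `A`-side a translate of a member of `SA` or its `B`-side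
a translate of a member of `SB`, then `s² · Σ_{v,w} B v w ≤ (|SA| + |SB|) · |G| · Σ_v B v v`. -/
theorem stub_thetaCommonSideClasses :
    ∀ (G : Type) [AddCommGroup G] [Fintype G] [DecidableEq G] (s : ℕ) (X₀ : Finset G)
      (SA SB : Finset (Finset G)) (B : Finset G × Finset G → Finset G × Finset G → ℝ),
      (∀ v w, B v w = B w v) →
      (∀ x : Finset G × Finset G → ℝ, 0 ≤ ∑ v, ∑ w, x v * B v w * x w) →
      (∀ v w, 0 ≤ B v w) →
      (∀ v w : Finset G × Finset G, B v w ≠ 0 →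
        (v.1.card = s ∧ v.2.card = s ∧
          (∀ a ∈ v.1, ∀ a' ∈ v.1, ∀ b ∈ v.2, ∀ b' ∈ v.2, (a - a') + (b - b') = 0 → a = a' ∧ b = b') ∧
          v.1 - v.2 ⊆ X₀) ∧
        (w.1.card = s ∧ w.2.card = s ∧
          (∀ a ∈ w.1, ∀ a' ∈ w.1, ∀ b ∈ w.2, ∀ b' ∈ w.2, (a - a') + (b - b') = 0 → a = a' ∧ b = b') ∧
          w.1 - w.2 ⊆ X₀) ∧
        (v = w ∨ (Disjoint (v.1 - w.2) X₀ ∧ Disjoint (w.1 - v.2) X₀))) →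
      (∀ v : Finset G × Finset G, B v v ≠ 0 →
        (∃ A₀ ∈ SA, ∃ x : G, v.1 = x +ᵥ A₀) ∨ (∃ B₀ ∈ SB, ∃ x : G, v.2 = x +ᵥ B₀)) →
      (s : ℝ) ^ 2 * ∑ v, ∑ w, B v w ≤
        ((SA.card : ℝ) + (SB.card : ℝ)) * (Fintype.card G : ℝ) * ∑ v, B v v :=
  fun _ _ _ _ s X₀ SA SB B hsymm hpsd hnn hsupp hcls =>
    sq_mul_value_le_of_commonSideClasses s X₀ SA SB B hsymm hpsd hnn hsupp hcls

end Summit.MatrixMultiplication.MatrixMultiplication.Theorems.PrimeLogDecayTheta.CommonSideClasses
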